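import Summits.BirchSwinnertonDyer.BirchSwinnertonDyer.Theorems.KimAtThreeDeepUpperOffStratumPortE
import Summits.BirchSwinnertonDyer.BirchSwinnertonDyer.Theorems.KimAtThreeShallowEqDeepSplitGlueNoStub
import HarnessLib

/-!
# Route `KimAtThreeKolyvagin` (rung W2), crux `DeepUpperAtThreeOffKatoStratum` (item 19562), registered
# stub `stub_additiveDefect`: the additive-defect rows from ONE lattice-index-free port — the scaling
# lemma, PORT″ ⟹ the free-exponent port on the Kato stratum, the Poitou–Tate / optimal-datum wrappers,
# and the STUB-SHAPED corollary

Cell `bsd-addord`, seat `bsd-addord-w2-acc1` (PROGRAMME PART 1b, ACCEL-LIST l.753 row (1)), item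
`stmt-BirchSwinnertonDyer-19562` (owner w2-c5; `--supports` helpers only; the owner assembles).  Sequel of
`KimAtThreeDeepUpperOffStratumPortE` (`deepUpper_conclusion_of_port_e`: cruxes 19076/19562 at a tower row
from [S24] ×2 + GZK + Poitou–Tate + ONE port with a FREE exponent — no reduction-type, `c₃`, `E(ℚ₃)[3]`,
Manin or period hypothesis).  Theorems only; nothing asserted about any curve; nothing booked.

* §1 `katoKuriharaWitnessAt_smul_of_twoExponent` — WHY the free-exponent port is the additive-defect
  dictionary: families `κ, κ′` and a functional `Λ` with n1011's clauses (0), (I4), (Λ) and the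
  TWO-EXPONENT law `3^{e₁}·Λ(loc κ_d) = u_d·3^{e₂}·δ̃_{n(d)}` (Kim 2026 Thm. 3.13 with Rem. 3.8 / Lemma
  3.10 CORRECTED at `p = 3`: local lattice `exp*_ω(H¹(ℚ₃,T)) = 3^{v₃(c₃)−t}ℤ₃` on Kodaira IV/IV*, and
  `Ω(E) = |c_D|·Ω⁺_f` at a lattice-optimal datum; `e₁ = v₃(c₃) + v₃(c_D)`, `e₂ = t`) give, after SCALING
  to `3^{e₁}•κ, 3^{e₁}•κ′`, the one-exponent witness `KatoKuriharaWitnessAt W k e₂ …`.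
* §2 `portE_of_portWith₂` — on the Kato stratum the registered PORT″ (= crux 19560) IMPLIES the
  free-exponent port at `e = 0` (so `deepUpper_conclusion_of_port_e … 0 (portE_of_portWith₂ …)` re-derives
  w2-c4's `deepUpper_conclusion_of_ports_noStub` — the new road contains the old one; not restated here,
  the gate's dedup lint forbids a verbatim twin of a landed statement).
* §3 wrappers: the crux's currency `ord(δ̃) = 0` and the Poitou–Tate families from the named fact.
* §4 the STUB-SHAPED corollaries for the owner: `deepUpper_optimalRows_of_portFamily` (EVERY optimal
  tower row, no case split, ⟸ [S24] ×2 + GZK + PT + the port FAMILY `HPort`, inline) and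
  `stub_additiveDefect_of_facts_of_portFamily` (the registered stub VERBATIM as conclusion ⟸ the same
  four facts + the port family restricted to the stub's rows).  Standing of the port family: at
  `E(ℚ₃)[3^∞] = 1` it is Kim's Thm. 3.13 two-exponent form scaled per §1 — the SAME debt class as crux
  19560 (explicit reciprocity), whereas the reading of record (w2-c5's (DD) `∂^{(∞)}_{deep} ≤ v₃(∏c_ℓ)`)
  is main-conjecture strength (w2-c3 `KimAtThreeDeepUpperDefectObstruction`); at `E(ℚ₃)[3] ≠ 1` the
  honest key is DEEP-class data (n1011 (B6)), which the pinned-class binder over-asks — flagged.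
[cite: Kim2025RefinedTNC, Thm 1.1, §5] [cite: Kim2022StructureSelmer, Thm. 1.9 (6), Thm. 3.13, Rem. 3.8, Lemma 3.10, Prop. 3.12]
[cite: MazurRubin2004, Thm. 3.2.4, App. A (33), Thm. 4.4.1, Thm. 5.2.12 (v)] [cite: Kato2004Asterisque, Thm. 12.5 (1)]
[cite: Sakamoto2024, Thm. 4.4 (1)(2) (p. 926)] [cite: MilneADT2006, Ch. I, Thm. 4.10]
-/

set_option autoImplicit false
-- the Theorems namespace of a single-conjunct summit repeats the summit name by design (D-0017)
set_option linter.dupNamespace false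

noncomputable section

open scoped Classical NumberField ContRepresentation
open Function Field NumberField IsDedekindDomain IsDedekindDomain.HeightOneSpectrum WeierstrassCurve
  CongruenceSubgroup
  Literature.NumberTheory.EllipticCurves Literature.NumberTheory.EllipticCurves.ModularForms
  Literature.NumberTheory.EllipticCurves.Rank1Residual
  Literature.NumberTheory.GaloisRepresentations
  Literature.NumberTheory.GaloisRepresentations.DiscreteGaloisModule Literature.NumberTheory.GaloisCohomology
  Rat.HeightOneSpectrum
  Summit.BirchSwinnertonDyer.Rank1Residual.GaloisImage
  Summit.BirchSwinnertonDyer.Rank1Residual.GaloisImage.Assembly Summit.BirchSwinnertonDyer.Rank1Residual.X4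
  Summit.BirchSwinnertonDyer.BirchSwinnertonDyer.Theorems
  Summit.BirchSwinnertonDyer.BirchSwinnertonDyer.Theorems.KimAtThreeKolyvaginUnitLevelOneRungs
  Summit.BirchSwinnertonDyer.BirchSwinnertonDyer.Theorems.KimAtThreeShallowEqDeepStubOfPorts
  Summit.BirchSwinnertonDyer.BirchSwinnertonDyer.Theorems.KimAtThreeDeepUpperOffStratumPortE
  Summit.BirchSwinnertonDyer.BirchSwinnertonDyer.Theorems.KimAtThreeShallowEqDeepSplitGlueNoStub
  Summit.BirchSwinnertonDyer.BirchSwinnertonDyer.Theorems.KimAtThreeDeepLowerKatoStratumOfFacts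

namespace Summit.BirchSwinnertonDyer.BirchSwinnertonDyer.Theorems.KimAtThreeDeepUpperAdditiveDefectOfPortE

/-! ## §1 The scaling lemma: a two-exponent dictionary is a one-exponent witness for the scaled family -/

/-- **Two-exponent value law ⟹ one-exponent witness for the scaled families.**  Depth `k`, datum `D`,
place `v₃`, parametrisation datum `P`; families `κ, κ′ : d ↦ H¹(ℚ, E[3^{k+1}])` and a functional `Λ` on
`H¹(ℚ₃, E[3^{k+1}])` with n1011's clauses (0) `κ_d ∈ H¹_{𝓕_can(d)}`, (I4) `κ′ ∈ KS₁` and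
`κ′_d − κ_d ∈ ℤ⟨κ_c : c ⊊ d⟩`, (Λ) onto with kernel the Kummer part, and the TWO-EXPONENT law
`3^{e₁}·Λ(loc κ_d) = u_d·3^{e₂}·δ̃^{(k+1)}_{n(d)}(ψ_d)` at every level (the additive-defect dictionary:
`e₁ = v₃(c₃) + v₃(c_D)`, `e₂ = t`; Kim 2026 Rem. 3.8 / Lemma 3.10 corrected at `p = 3`).  Then
`(3^{e₁}•κ, Λ, 3^{e₁}•κ′)` satisfies `KatoKuriharaWitnessAt W k e₂ D v₃ P` — the currency of every landed
END theorem of the route, with `e₂` in the slot of `t`. [cite: Kim2022StructureSelmer, Thm. 3.13, Rem. 3.8, Lemma 3.10 and Prop. 3.12]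
[cite: MazurRubin2004, Thm. 3.2.4 and App. A (33)] -/
theorem katoKuriharaWitnessAt_smul_of_twoExponent
    (W : WeierstrassCurve ℚ) [W.IsElliptic] [W.IsGloballyMinimal] (k e₁ e₂ : ℕ)
    (D : KolyvaginDatum (W.torsionGaloisModule (((3 : ℕ) : ℤ) ^ k * ((3 : ℕ) : ℤ))))
    (v₃ : HeightOneSpectrum (𝓞 ℚ)) {N : ℕ} [NeZero N] (P : ModularParametrizationData W N)
    (κ : Finset (HeightOneSpectrum (𝓞 ℚ)) →
      galoisCohomology (W.torsionGaloisModule (((3 : ℕ) : ℤ) ^ k * ((3 : ℕ) : ℤ))) 1)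
    (Λ : galoisCohomology ((W.torsionGaloisModule (((3 : ℕ) : ℤ) ^ k * ((3 : ℕ) : ℤ))).toLocal
      (Sum.inr v₃)) 1 →+ ZMod (3 ^ (k + 1)))
    (κ' : Finset (HeightOneSpectrum (𝓞 ℚ)) →
      galoisCohomology (W.torsionGaloisModule (((3 : ℕ) : ℤ) ^ k * ((3 : ℕ) : ℤ))) 1)
    -- (0)
    (h0 : ∀ d, D.IsLevel d → κ d ∈ (D.atLevel (propagatedSelmerStructure W 3 k) d).selmerGroup)
    -- (I4)
    (hKS : κ' ∈ D.kolyvaginSystems (propagatedSelmerStructure W 3 k))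
    (hbr : ∀ d, D.IsLevel d → κ' d - κ d ∈ AddSubgroup.closure {x | ∃ c, c ⊂ d ∧ x = κ c})
    -- (Λ)
    (hon : ∀ r : ZMod (3 ^ (k + 1)), ∃ x ∈ propagatedSelmerStructure W 3 k (Sum.inr v₃), Λ x = r)
    (hker : ∀ x ∈ propagatedSelmerStructure W 3 k (Sum.inr v₃),
      Λ x = 0 ↔ x ∈ W.kummerSelmerStructure (((3 : ℕ) : ℤ) ^ k * ((3 : ℕ) : ℤ)) (Sum.inr v₃))
    -- (DICT3, two exponents)
    (hdict₂ : ∀ (d : Finset (HeightOneSpectrum (𝓞 ℚ))), D.IsLevel d →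
      ∃ (u : (ZMod (3 ^ (k + 1)))ˣ)
        (ψ : (ℓ : ℕ) → (ZMod ℓ)ˣ →* Multiplicative (ZMod (3 ^ (k + 1)))),
        (∀ q ∈ d, Function.Surjective (ψ (Ideal.absNorm q.asIdeal))) ∧
        haveI : NeZero (∏ q ∈ d, Ideal.absNorm q.asIdeal) :=
          ⟨Finset.prod_ne_zero_iff.2 fun q _ h => q.ne_bot (Ideal.absNorm_eq_zero_iff.1 h)⟩
        ((3 ^ e₁ : ℕ) : ZMod (3 ^ (k + 1))) * Λ (galoisCohomology.localization _ (Sum.inr v₃) 1 (κ d)) =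
          (u : ZMod (3 ^ (k + 1))) * ((3 ^ e₂ : ℕ) : ZMod (3 ^ (k + 1))) *
            kuriharaNumber P.f (3 ^ (k + 1)) (∏ q ∈ d, Ideal.absNorm q.asIdeal) ψ) :
    KatoKuriharaWitnessAt W k e₂ D v₃ P (fun d => 3 ^ e₁ • κ d) Λ (fun d => 3 ^ e₁ • κ' d) := by
  haveI : Fact (Nat.Prime 3) := ⟨Nat.prime_three⟩
  refine ⟨fun d hd => AddSubgroup.nsmul_mem _ (h0 d hd) _, ⟨?_, fun d hd => ?_⟩, hon, hker, fun d hd => ?_⟩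
  · -- `3^{e₁} • κ′ ∈ KS₁` (a `ℤ`-module)
    have h : (fun d => 3 ^ e₁ • κ' d) = 3 ^ e₁ • κ' := by
      funext d
      rfl
    rw [h]
    exact AddSubgroup.nsmul_mem _ hKS _
  · -- the bridge: apply `x ↦ 3^{e₁} • x` to `κ′_d − κ_d ∈ ℤ⟨κ_c : c ⊊ d⟩`
    set φ : galoisCohomology (W.torsionGaloisModule (((3 : ℕ) : ℤ) ^ k * ((3 : ℕ) : ℤ))) 1 →+
        galoisCohomology (W.torsionGaloisModule (((3 : ℕ) : ℤ) ^ k * ((3 : ℕ) : ℤ))) 1 :=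
      nsmulAddMonoidHom (3 ^ e₁) with hφ
    have himage : φ '' {x | ∃ c, c ⊂ d ∧ x = κ c} = {x | ∃ c, c ⊂ d ∧ x = 3 ^ e₁ • κ c} := by
      ext x
      simp only [Set.mem_image, Set.mem_setOf_eq]
      constructor
      · rintro ⟨y, ⟨c, hc, rfl⟩, rfl⟩
        exact ⟨c, hc, rfl⟩
      · rintro ⟨c, hc, rfl⟩
        exact ⟨κ c, ⟨c, hc, rfl⟩, rfl⟩
    have hmem : φ (κ' d - κ d) ∈ (AddSubgroup.closure {x | ∃ c, c ⊂ d ∧ x = κ c}).map φ :=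
      AddSubgroup.mem_map_of_mem φ (hbr d hd)
    rw [AddMonoidHom.map_closure, himage, map_sub] at hmem
    simpa [hφ] using hmem
  · -- the value law for the scaled class: `Λ(loc (3^{e₁}•κ_d)) = 3^{e₁}·Λ(loc κ_d) = u·3^{e₂}·δ̃`
    obtain ⟨u, ψ, hψ, hval⟩ := hdict₂ d hd
    refine ⟨u, ψ, hψ, ?_⟩
    rw [map_nsmul, map_nsmul, nsmul_eq_mul]
    push_cast at hval ⊢
    rw [hval]

/-! ## §2 The Kato stratum: PORT″ ⟹ the free-exponent port at `e = 0` -/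

/-- **PORT″ ⟹ the free-exponent port, on the Kato stratum.**  For `W` with ADDITIVE reduction at `3`,
`3 ∤ c₃`, `ρ̄_{E,3}` onto, `E(ℚ₃)[3] = 1`, a place `v₃ ∣ 3`, a datum `P` with `3 ∤ c_P` and the unit
period transfer, the registered PORT″ `KatoKuriharaPortThreeAtWith₂ W 0 v₃ η P` (crux 19560) gives, at
every pinned `η`-canonical datum of every depth, witnesses `KatoKuriharaWitnessAt W k 0 …` — the port
binder `hPort` of `deepUpper_conclusion_of_port_e` at `e = 0` (call PORT″ at `k = k′` with the pinned
reduction `exists_torsionReduction_three W k k`, keep the depth-`k` witness, drop (COMP)).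
[cite: Kim2022StructureSelmer, Thm. 3.13] [cite: Kato2004Asterisque, Thm. 12.5 (1)] -/
theorem portE_of_portWith₂
    (W : WeierstrassCurve ℚ) [W.IsElliptic] [W.IsGloballyMinimal]
    (hadd : haveI : Fact (Nat.Prime 3) := ⟨Nat.prime_three⟩; Addv W 3)
    (hc3 : ¬ 3 ∣ (W.baseChange ℚ_[3]).localTamagawaNumber ℤ_[3])
    (hsurj : W.HasSurjectiveModNGaloisRep ((3 : ℕ) : ℤ))
    (ht0 : Nat.card {Q : (W.baseChange ℚ_[3]).toAffine.Point // (3 : ℕ) • Q = 0} = 1)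
    {N : ℕ} [NeZero N] (P : ModularParametrizationData W N) (hcP : ¬ (3 : ℤ) ∣ P.maninConstant)
    (hper : ∃ u : ℚ, ‖(u : ℚ_[3])‖ = 1 ∧ W.realPeriodRat = u * plusPeriod P.f)
    (v₃ : HeightOneSpectrum (𝓞 ℚ)) (hv₃ : ((3 : ℕ) : 𝓞 ℚ) ∈ v₃.asIdeal)
    (η : (q : HeightOneSpectrum (𝓞 ℚ)) → (ZMod (Ideal.absNorm q.asIdeal))ˣ)
    (hPort : KatoKuriharaPortThreeAtWith₂ W 0 v₃ η P) :
    ∀ (k : ℕ) (Dk : KolyvaginDatum (W.torsionGaloisModule (((3 : ℕ) : ℤ) ^ k * ((3 : ℕ) : ℤ)))),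
      Dk.IsCanonicalTauDatumThreeAtWith W k k η →
      ∃ (κ : Finset (HeightOneSpectrum (𝓞 ℚ)) →
            galoisCohomology (W.torsionGaloisModule (((3 : ℕ) : ℤ) ^ k * ((3 : ℕ) : ℤ))) 1)
        (Λ : galoisCohomology ((W.torsionGaloisModule (((3 : ℕ) : ℤ) ^ k * ((3 : ℕ) : ℤ))).toLocal
            (Sum.inr v₃)) 1 →+ ZMod (3 ^ (k + 1)))
        (κ' : Finset (HeightOneSpectrum (𝓞 ℚ)) →
            galoisCohomology (W.torsionGaloisModule (((3 : ℕ) : ℤ) ^ k * ((3 : ℕ) : ℤ))) 1),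
        KatoKuriharaWitnessAt W k 0 Dk v₃ P κ Λ κ' := by
  haveI : Fact (Nat.Prime 3) := ⟨Nat.prime_three⟩
  intro k Dk hDk
  have hcP' : ¬ ((3 : ℕ) : ℤ) ∣ P.maninConstant := by exact_mod_cast hcP
  have ht0' : Nat.card {Q : (W.baseChange ℚ_[3]).toAffine.Point // (3 : ℕ) • Q = 0} = 3 ^ 0 := by
    rw [ht0, pow_zero]
  obtain ⟨red, hred⟩ := exists_torsionReduction_three W k k
  have hDk' : Dk.IsCanonicalTauDatumThreeAtWith W (k + 0) k η := by simpa using hDk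
  obtain ⟨κ, Λ, κ', -, -, -, hW, -, -⟩ :=
    hPort k k Dk Dk red hDk' hDk' le_rfl hred hadd hc3 hsurj ht0' hv₃ hcP' hper
  exact ⟨κ, Λ, κ', hW⟩

/-! ## §3 Wrappers: the crux's currency and the Poitou–Tate named fact -/

/-- **The row in the crux's currency** (`ord(δ̃) = 0` instead of `L(E,1) ≠ 0`), any datum, free exponent. [cite: Kim2025RefinedTNC, Thm 1.1] -/
theorem deepUpper_datum_of_port_e
    (hS24 : Sakamoto2024.kolyvaginSystems_freeRankOne_zmod_three_pow)
    (hS24₂ : Sakamoto2024.kolyvaginSystems_idealOfBasis_eq_fittingIdeal_zmod_three_pow)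
    (hGZK : rank_eq_analyticRank_of_analyticRank_le_one)
    (W : WeierstrassCurve ℚ) [W.IsElliptic] [W.IsGloballyMinimal]
    (htower : ∀ m : ℕ, W.HasSurjectiveModNGaloisRep (3 ^ m : ℕ))
    {N : ℕ} [NeZero N] (D : ModularParametrizationData W N)
    (hint : ∀ r : ℚ, ratPlusSymbol D.f r ≠ 0 → 0 ≤ padicValRat 3 (ratPlusSymbol D.f r))
    (hord : kuriharaVanishingOrder W 3 D.f = 0)
    (inv : LocalInvariants ℚ 3) (hperf : inv.IsPerfect) (hsum : inv.SumLocalTermEqZero)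
    (hcompl : inv.SelmerComplement)
    (inv' : ∀ k' : ℕ, LocalInvariants ℚ (3 ^ (k' + 1))) (hperf' : ∀ k', (inv' k').IsPerfect)
    (hsum' : ∀ k', (inv' k').SumLocalTermEqZero) (hcompl' : ∀ k', (inv' k').SelmerComplement)
    (hinj' : ∀ k', ∀ v : HeightOneSpectrum (𝓞 ℚ), Injective (inv' k' (Sum.inr v)))
    (v₃ : HeightOneSpectrum (𝓞 ℚ)) (hv₃ : ((3 : ℕ) : 𝓞 ℚ) ∈ v₃.asIdeal)
    (η : (q : HeightOneSpectrum (𝓞 ℚ)) → (ZMod (Ideal.absNorm q.asIdeal))ˣ)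
    (hη : ∀ q : HeightOneSpectrum (𝓞 ℚ), Subgroup.zpowers (η q) = ⊤)
    (e : ℕ)
    (hPort : ∀ (k : ℕ)
      (Dk : KolyvaginDatum (W.torsionGaloisModule (((3 : ℕ) : ℤ) ^ k * ((3 : ℕ) : ℤ)))),
      Dk.IsCanonicalTauDatumThreeAtWith W k k η →
      ∃ (κ : Finset (HeightOneSpectrum (𝓞 ℚ)) →
            galoisCohomology (W.torsionGaloisModule (((3 : ℕ) : ℤ) ^ k * ((3 : ℕ) : ℤ))) 1)
        (Λ : galoisCohomology ((W.torsionGaloisModule (((3 : ℕ) : ℤ) ^ k * ((3 : ℕ) : ℤ))).toLocal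
            (Sum.inr v₃)) 1 →+ ZMod (3 ^ (k + 1)))
        (κ' : Finset (HeightOneSpectrum (𝓞 ℚ)) →
            galoisCohomology (W.torsionGaloisModule (((3 : ℕ) : ℤ) ^ k * ((3 : ℕ) : ℤ))) 1),
        KatoKuriharaWitnessAt W k e Dk v₃ D κ Λ κ') :
    ∃ dd : ℕ, kuriharaPartialDeepInfty W 3 D.f = dd ∧
      ((padicValNat 3 (Nat.card (AddCommGroup.primaryComponent W.sha 3)) + dd : ℕ) : ℕ∞) ≤
        kuriharaPartial W 3 D.f 0 := by
  haveI : Fact (Nat.Prime 3) := ⟨Nat.prime_three⟩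
  have h0 : ratPlusSymbol D.f 0 ≠ 0 :=
    ratPlusSymbol_zero_ne_zero_of_kuriharaVanishingOrder_eq_zero W 3 D.f hord
  have hL : W.entireLFunction 1 ≠ 0 :=
    D.isNewformOf.entireLFunction_one_ne_zero_of_ratPlusSymbol_zero_ne_zero h0
  exact deepUpper_conclusion_of_port_e hS24 hS24₂ hGZK W htower hL D hint inv hperf hsum hcompl inv' hperf'
    hsum' hcompl' hinj' v₃ hv₃ η hη e hPort

/-- **The row from THREE named published facts + ONE port**: the Poitou–Tate binders supplied by the
named fact `poitouTate_selmerStructure_duality ℚ`. [cite: MilneADT2006, Ch. I, Thm. 4.10] [cite: Kim2025RefinedTNC, Thm 1.1] -/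
theorem deepUpper_datum_of_poitouTate_of_port_e
    (hS24 : Sakamoto2024.kolyvaginSystems_freeRankOne_zmod_three_pow)
    (hS24₂ : Sakamoto2024.kolyvaginSystems_idealOfBasis_eq_fittingIdeal_zmod_three_pow)
    (hGZK : rank_eq_analyticRank_of_analyticRank_le_one)
    (hPT : poitouTate_selmerStructure_duality ℚ)
    (W : WeierstrassCurve ℚ) [W.IsElliptic] [W.IsGloballyMinimal]
    (htower : ∀ m : ℕ, W.HasSurjectiveModNGaloisRep (3 ^ m : ℕ))
    {N : ℕ} [NeZero N] (D : ModularParametrizationData W N)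
    (hint : ∀ r : ℚ, ratPlusSymbol D.f r ≠ 0 → 0 ≤ padicValRat 3 (ratPlusSymbol D.f r))
    (hord : kuriharaVanishingOrder W 3 D.f = 0)
    (v₃ : HeightOneSpectrum (𝓞 ℚ)) (hv₃ : ((3 : ℕ) : 𝓞 ℚ) ∈ v₃.asIdeal)
    (η : (q : HeightOneSpectrum (𝓞 ℚ)) → (ZMod (Ideal.absNorm q.asIdeal))ˣ)
    (hη : ∀ q : HeightOneSpectrum (𝓞 ℚ), Subgroup.zpowers (η q) = ⊤)
    (e : ℕ)
    (hPort : ∀ (k : ℕ)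
      (Dk : KolyvaginDatum (W.torsionGaloisModule (((3 : ℕ) : ℤ) ^ k * ((3 : ℕ) : ℤ)))),
      Dk.IsCanonicalTauDatumThreeAtWith W k k η →
      ∃ (κ : Finset (HeightOneSpectrum (𝓞 ℚ)) →
            galoisCohomology (W.torsionGaloisModule (((3 : ℕ) : ℤ) ^ k * ((3 : ℕ) : ℤ))) 1)
        (Λ : galoisCohomology ((W.torsionGaloisModule (((3 : ℕ) : ℤ) ^ k * ((3 : ℕ) : ℤ))).toLocal
            (Sum.inr v₃)) 1 →+ ZMod (3 ^ (k + 1)))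
        (κ' : Finset (HeightOneSpectrum (𝓞 ℚ)) →
            galoisCohomology (W.torsionGaloisModule (((3 : ℕ) : ℤ) ^ k * ((3 : ℕ) : ℤ))) 1),
        KatoKuriharaWitnessAt W k e Dk v₃ D κ Λ κ') :
    ∃ dd : ℕ, kuriharaPartialDeepInfty W 3 D.f = dd ∧
      ((padicValNat 3 (Nat.card (AddCommGroup.primaryComponent W.sha 3)) + dd : ℕ) : ℕ∞) ≤
        kuriharaPartial W 3 D.f 0 := by
  haveI : Fact (Nat.Prime 3) := ⟨Nat.prime_three⟩
  obtain ⟨inv, hperf, hsum, -, hcompl⟩ := hPT 3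
  obtain ⟨inv', hperf', hsum', hcompl', hinj'⟩ := exists_localInvariants_three_pow_of_poitouTate hPT
  exact deepUpper_datum_of_port_e hS24 hS24₂ hGZK W htower D hint hord inv hperf hsum hcompl inv' hperf'
    hsum' hcompl' hinj' v₃ hv₃ η hη e hPort

/-! ## §4 The stub-shaped corollaries for the owner of 19562 -/

/-- **Every optimal tower row of crux 19562 (and of 19076 in kim3's optimal-datum currency), from four
named facts and the port FAMILY — no case split on the reduction type.**  `HPort` (inline): for every
tower-surjective `W`, every place `v₃ ∣ 3`, generator family `η`, and every lattice-optimal datum `P` at the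
conductor, SOME exponent `e` and, at every pinned `η`-canonical datum of every depth, witnesses
`KatoKuriharaWitnessAt W k e …`.  Conclusion: the common body of the two registered stubs of 19562 (the
binders of `stub_nonAdditive` / `stub_additiveDefect` without their last antecedent).
[cite: Kim2025RefinedTNC, Thm 1.1] [cite: Sakamoto2024, Thm. 4.4 (1)(2) (p. 926)]
[cite: MilneADT2006, Ch. I, Thm. 4.10] -/
theorem deepUpper_optimalRows_of_portFamily
    (hS24 : Sakamoto2024.kolyvaginSystems_freeRankOne_zmod_three_pow)
    (hS24₂ : Sakamoto2024.kolyvaginSystems_idealOfBasis_eq_fittingIdeal_zmod_three_pow)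
    (hGZK : rank_eq_analyticRank_of_analyticRank_le_one)
    (hPT : poitouTate_selmerStructure_duality ℚ)
    (HPort : ∀ (W : WeierstrassCurve ℚ) [W.IsElliptic] [W.IsGloballyMinimal],
      (∀ m : ℕ, W.HasSurjectiveModNGaloisRep (3 ^ m : ℕ)) →
      ∀ (v₃ : HeightOneSpectrum (𝓞 ℚ)), ((3 : ℕ) : 𝓞 ℚ) ∈ v₃.asIdeal →
      ∀ (η : (q : HeightOneSpectrum (𝓞 ℚ)) → (ZMod (Ideal.absNorm q.asIdeal))ˣ),
        (∀ q, Subgroup.zpowers (η q) = ⊤) →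
      ∀ {N : ℕ} [NeZero N] (P : ModularParametrizationData W N), N = W.conductorNorm ℤ →
        (∀ z ∈ P.L.lattice, ∃ w ∈ periodLattice P.f, z = P.c * w) →
        ∃ e : ℕ, ∀ (k : ℕ)
          (Dk : KolyvaginDatum (W.torsionGaloisModule (((3 : ℕ) : ℤ) ^ k * ((3 : ℕ) : ℤ)))),
          Dk.IsCanonicalTauDatumThreeAtWith W k k η →
          ∃ (κ : Finset (HeightOneSpectrum (𝓞 ℚ)) →
                galoisCohomology (W.torsionGaloisModule (((3 : ℕ) : ℤ) ^ k * ((3 : ℕ) : ℤ))) 1)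
            (Λ : galoisCohomology ((W.torsionGaloisModule (((3 : ℕ) : ℤ) ^ k * ((3 : ℕ) : ℤ))).toLocal
                (Sum.inr v₃)) 1 →+ ZMod (3 ^ (k + 1)))
            (κ' : Finset (HeightOneSpectrum (𝓞 ℚ)) →
                galoisCohomology (W.torsionGaloisModule (((3 : ℕ) : ℤ) ^ k * ((3 : ℕ) : ℤ))) 1),
            KatoKuriharaWitnessAt W k e Dk v₃ P κ Λ κ') :
    ∀ (W₀ : WeierstrassCurve ℚ) [W₀.IsElliptic] [W₀.IsGloballyMinimal],
      (∀ n : ℕ, W₀.HasSurjectiveModNGaloisRep (3 ^ n : ℕ)) → Finite W₀.sha →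
      ∀ {N : ℕ} [NeZero N], N = W₀.conductorNorm ℤ →
      ∀ (D₀ : ModularParametrizationData W₀ N),
        (∀ z ∈ D₀.L.lattice, ∃ w ∈ periodLattice D₀.f, z = D₀.c * w) →
        (∀ (W₂ : WeierstrassCurve ℚ) [W₂.IsElliptic] (D₂ : ModularParametrizationData W₂ N),
          D₂.f = D₀.f → D₀.modularDegree ≤ D₂.modularDegree) →
        (∀ r : ℚ, ratPlusSymbol D₀.f r ≠ 0 → 0 ≤ padicValRat 3 (ratPlusSymbol D₀.f r)) →
        kuriharaVanishingOrder W₀ 3 D₀.f = 0 →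
        ∃ d : ℕ, kuriharaPartialDeepInfty W₀ 3 D₀.f = d ∧
          ((padicValNat 3 (Nat.card (AddCommGroup.primaryComponent W₀.sha 3)) + d : ℕ) : ℕ∞) ≤
            kuriharaPartial W₀ 3 D₀.f 0 := by
  intro W₀ _ _ htow _ N _ hN D₀ hopt _ hint hord
  obtain ⟨v₃, η, hv₃, hη⟩ := exists_place_three_and_generators
  obtain ⟨e, hPort⟩ := HPort W₀ htow v₃ hv₃ η hη D₀ hN hopt
  exact deepUpper_datum_of_poitouTate_of_port_e hS24 hS24₂ hGZK hPT W₀ htow D₀ hint hord v₃ hv₃ η hη e hPort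

/-- **The registered stub `stub_additiveDefect` of crux 19562 VERBATIM as conclusion, from four named
published facts and the port family RESTRICTED TO THE STUB'S ROWS** (antecedents inside `HPortDefect`:
the tower, `Addv W 3`, the datum lattice-optimal at the conductor, the defect disjunction).  Standing of
`HPortDefect`: on `#E(ℚ₃)[3^∞] = 1` rows (IV/IV* `3 ∣ c₃`, `3 ∣ c_P`) it is Kim's Thm. 3.13 dictionary with
the lattice index carried (`e = 0` after scaling by `3^{v₃(c₃)+v₃(c_P)}`, §1) — NOT in print at `3`, the SAME
debt class as crux 19560; on `E(ℚ₃)[3] ≠ 1` rows the honest key is DEEP-class data (n1011 (B6)), which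
this pinned-class binder does not distinguish — flagged for the owner / planner.
[cite: Kim2025RefinedTNC, Thm 1.1] [cite: Kim2022StructureSelmer, Thm. 3.13, Rem. 3.8 and Lemma 3.10]
[cite: Sakamoto2024, Thm. 4.4 (1)(2) (p. 926)] [cite: MilneADT2006, Ch. I, Thm. 4.10] -/
theorem stub_additiveDefect_of_facts_of_portFamily
    (hS24 : Sakamoto2024.kolyvaginSystems_freeRankOne_zmod_three_pow)
    (hS24₂ : Sakamoto2024.kolyvaginSystems_idealOfBasis_eq_fittingIdeal_zmod_three_pow)
    (hGZK : rank_eq_analyticRank_of_analyticRank_le_one)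
    (hPT : poitouTate_selmerStructure_duality ℚ)
    (HPortDefect : ∀ (W : WeierstrassCurve ℚ) [W.IsElliptic] [W.IsGloballyMinimal],
      (∀ m : ℕ, W.HasSurjectiveModNGaloisRep (3 ^ m : ℕ)) →
      (haveI : Fact (Nat.Prime 3) := ⟨Nat.prime_three⟩; Addv W 3) →
      ∀ (v₃ : HeightOneSpectrum (𝓞 ℚ)), ((3 : ℕ) : 𝓞 ℚ) ∈ v₃.asIdeal →
      ∀ (η : (q : HeightOneSpectrum (𝓞 ℚ)) → (ZMod (Ideal.absNorm q.asIdeal))ˣ),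
        (∀ q, Subgroup.zpowers (η q) = ⊤) →
      ∀ {N : ℕ} [NeZero N] (P : ModularParametrizationData W N), N = W.conductorNorm ℤ →
        (∀ z ∈ P.L.lattice, ∃ w ∈ periodLattice P.f, z = P.c * w) →
        (3 ∣ (W.baseChange ℚ_[3]).localTamagawaNumber ℤ_[3] ∨
          Nat.card {Q : (W.baseChange ℚ_[3]).toAffine.Point // (3 : ℕ) • Q = 0} ≠ 1 ∨
          (3 : ℤ) ∣ P.maninConstant) →
        ∃ e : ℕ, ∀ (k : ℕ)
          (Dk : KolyvaginDatum (W.torsionGaloisModule (((3 : ℕ) : ℤ) ^ k * ((3 : ℕ) : ℤ)))),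
          Dk.IsCanonicalTauDatumThreeAtWith W k k η →
          ∃ (κ : Finset (HeightOneSpectrum (𝓞 ℚ)) →
                galoisCohomology (W.torsionGaloisModule (((3 : ℕ) : ℤ) ^ k * ((3 : ℕ) : ℤ))) 1)
            (Λ : galoisCohomology ((W.torsionGaloisModule (((3 : ℕ) : ℤ) ^ k * ((3 : ℕ) : ℤ))).toLocal
                (Sum.inr v₃)) 1 →+ ZMod (3 ^ (k + 1)))
            (κ' : Finset (HeightOneSpectrum (𝓞 ℚ)) →
                galoisCohomology (W.torsionGaloisModule (((3 : ℕ) : ℤ) ^ k * ((3 : ℕ) : ℤ))) 1),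
            KatoKuriharaWitnessAt W k e Dk v₃ P κ Λ κ') :
    ∀ (W₀ : WeierstrassCurve ℚ) [W₀.IsElliptic] [W₀.IsGloballyMinimal],
      (∀ n : ℕ, W₀.HasSurjectiveModNGaloisRep (3 ^ n : ℕ)) → Finite W₀.sha →
      ∀ {N : ℕ} [NeZero N], N = W₀.conductorNorm ℤ →
      ∀ (D₀ : Literature.NumberTheory.EllipticCurves.ModularForms.ModularParametrizationData W₀ N),
        (∀ z ∈ D₀.L.lattice, ∃ w ∈ Literature.NumberTheory.EllipticCurves.ModularForms.periodLattice D₀.f, z = D₀.c * w) →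
        (∀ (W₂ : WeierstrassCurve ℚ) [W₂.IsElliptic]
          (D₂ : Literature.NumberTheory.EllipticCurves.ModularForms.ModularParametrizationData W₂ N),
          D₂.f = D₀.f → D₀.modularDegree ≤ D₂.modularDegree) →
        (∀ r : ℚ, Literature.NumberTheory.EllipticCurves.ratPlusSymbol D₀.f r ≠ 0 →
          0 ≤ padicValRat 3 (Literature.NumberTheory.EllipticCurves.ratPlusSymbol D₀.f r)) →
        Literature.NumberTheory.EllipticCurves.kuriharaVanishingOrder W₀ 3 D₀.f = 0 →
        (haveI : Fact (Nat.Prime 3) := ⟨Nat.prime_three⟩;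
            Literature.NumberTheory.EllipticCurves.Rank1Residual.Addv W₀ 3) →
        (3 ∣ (W₀.baseChange ℚ_[3]).localTamagawaNumber ℤ_[3] ∨
          Nat.card {Q : (W₀.baseChange ℚ_[3]).toAffine.Point // (3 : ℕ) • Q = 0} ≠ 1 ∨
          (3 : ℤ) ∣ D₀.maninConstant) →
        ∃ d : ℕ, Literature.NumberTheory.EllipticCurves.kuriharaPartialDeepInfty W₀ 3 D₀.f = d ∧
          ((padicValNat 3 (Nat.card (AddCommGroup.primaryComponent W₀.sha 3)) + d : ℕ) : ℕ∞) ≤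
            Literature.NumberTheory.EllipticCurves.kuriharaPartial W₀ 3 D₀.f 0 := by
  intro W₀ _ _ htow _ N _ hN D₀ hopt _ hint hord hA hdef
  obtain ⟨v₃, η, hv₃, hη⟩ := exists_place_three_and_generators
  obtain ⟨e, hPort⟩ := HPortDefect W₀ htow hA v₃ hv₃ η hη D₀ hN hopt hdef
  exact deepUpper_datum_of_poitouTate_of_port_e hS24 hS24₂ hGZK hPT W₀ htow D₀ hint hord v₃ hv₃ η hη e hPort

end Summit.BirchSwinnertonDyer.BirchSwinnertonDyer.Theorems.KimAtThreeDeepUpperAdditiveDefectOfPortE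

end
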